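import Literature.AnabelianGeometry.EtaleTheta.Discharge.Sec4Remark411DescentOfGaloisAction
import HarnessLib

/-!
# [EtTh] Remark 4.1.1, second clause — the descent inputs (Q), (Φ), (B) over Def. 3.3's `D₀` proper
# (the CONNECTED coverings dominated by one universal combinatorial covering)

S. Mochizuki, *The étale theta function …*, Publ. RIMS **45** (2009) [MochizukiEtTh2009], §4, Remark 4.1.1,
PDF p.88 (printed p.314) [cite: MochizukiEtTh2009, Rmk 4.1.1 p.88]; §3 p.72 "`D₀ := B^temp(X^log)⁰` … the full
subcategory constituted by the connected objects" and Def. 3.3 (iii) p.73.  S. Mochizuki, *Semi-graphs of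
anabelioids*, Publ. RIMS **42** (2006) [MochizukiSemiAnbd2006], Remark 3.1.3 p.34 (Galois objects: `Aut(Π/N) = Π/N`
acts transitively).

abc-iut cell, block F, seat abc-iut-f-108 (gen 3), FACT-LIST row F-0729 (`BiKummerSetting.Remark411`).  PROOF-ONLY
sequel of `Discharge/Sec4Remark411DescentOfGaloisAction.lean` (same seat: `G`-set descent along deck-transitive
covering maps; (Q) categorical quotient; (Φ)/(B) descent in `Φ₀ = Hom_G(−, Div⁺(Z^log_∞))`,
`B₀ = Hom_G(−, Mero(Z^log_∞))`), read in the full subcategory `isConnectedGSet.FullSubcategory` of nonempty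
transitive `G`-sets — Def. 3.3's `D₀` at one term of the inductive limit (abc-iut-w5-d179 lineage,
`DivisorMonoidsOfGaloisCoveringConnected.lean`, record `DivisorMonoids.ofGaloisActionConnected A hZ`), where every
covering map is surjective (`hom_surjective_of_isConnectedGSet`).  Contents:

* `exists_deck_obj_of_exists_deck`, `exists_deck_connected_of_galois`, `exists_deck_quotient_connected` — deck
  transformations in `D₀` proper vs. in the `G`-sets (the inclusion is fully faithful); Galois connected coverings
  (`Aut`-transitive; in particular `G/N`, `N ⊴ G`) are deck-transitive over every covering map;
* `ofGaloisActionConnected_Φ₀_descent`, `ofGaloisActionConnected_B₀_descent` — (Φ), (B): deck-invariant elements of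
  `Φ₀(Y)`, `B₀(Y)` descend UNIQUELY along a deck-transitive covering map of connected coverings;
* `existsUnique_fac_connected` — (Q): such a covering map is a categorical quotient by its deck group IN `D₀` proper;
* `ofGaloisActionConnected_galoisDescent` — (Φ) ∧ (B) out of a Galois connected covering in EXACTLY the binder shape
  (`hΦ`: descent ∧ `pullGp` injective; `hB`: descent ∧ `pull` injective) of abc-iut-f-108 gen 0's
  `BaseFrobeniusTypeData.existsUnique_fac_of_descent` (`Discharge/Sec4Remark411Quotient.lean`), NO residual hypothesis;
  `ofGaloisActionConnected_galoisDescent_quotient` — (Q) ∧ (Φ) ∧ (B) at the Galois coverings `G/N`, `N ⊴ G`.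

So all three inputs to which Remark 4.1.1's conjunct (2) was reduced HOLD, unconditionally, for print's Def. 3.3
(iii) data over print's `D₀` (one term of the limit); at the tree's §4 setting over `B^temp(Π^tp_X)⁰` with
ABSTRACT divisor data they remain the hypotheses of `remark411_mkOfConnectedTemperoid_of_galoisDescent` (gen 2)
only for want of the identification of that data with this construction (TODO-merge(abc-iut-L3-t2)).  HONEST
FRAMING: elementary `G`-set descent; nothing here bears on [IUTchIII] Cor. 3.12; typed ≠ proved for Remark 4.1.1 at
the genuine tempered Frobenioid of a curve.
-/

namespace Literature.AnabelianGeometry.EtaleTheta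

open CategoryTheory Opposite Literature.AlgebraicGeometry.Frobenioids

universe u

namespace DivisorMonoids

open LogDivisorModel.GaloisAction

variable {Z : LogDivisorModel.{u}} {G : Type u} [Group G] (A : Z.GaloisAction G) (hZ : Z.CuspLaws)

/-- Automorphisms of a connected covering in `D₀` proper are automorphisms of the underlying `G`-set (the
inclusion of the full subcategory is fully faithful). [cite: MochizukiEtTh2009, Def 3.3 p.73] -/
theorem exists_deck_obj_of_exists_deck {Y Y' : (isConnectedGSet (G := G)).FullSubcategory} (f : Y ⟶ Y')
    (hdeck : ∀ s₁ s₂ : Y.obj.V, f.hom.hom s₁ = f.hom.hom s₂ →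
      ∃ σ : Aut Y, σ.hom ≫ f = f ∧ σ.hom.hom.hom s₁ = s₂)
    (s₁ s₂ : Y.obj.V) (h : f.hom.hom s₁ = f.hom.hom s₂) :
    ∃ σ : Aut Y.obj, σ.hom ≫ f.hom = f.hom ∧ σ.hom.hom s₁ = s₂ := by
  obtain ⟨σ, hσf, hσ⟩ := hdeck s₁ s₂ h
  exact ⟨(isConnectedGSet (G := G)).ι.mapIso σ, congrArg InducedCategory.Hom.hom hσf, hσ⟩

/-- **(Φ) over `D₀` proper (`DivisorMonoids.ofGaloisActionConnected`)**: along a covering map `f : Y → Y′` of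
CONNECTED coverings (automatically surjective) whose deck transformations act transitively on the fibres, a
deck-invariant element of `Φ₀(Y)` is `Φ₀(f)` of a unique element of `Φ₀(Y′)`. [cite: MochizukiEtTh2009, Def 3.3 p.73] -/
theorem ofGaloisActionConnected_Φ₀_descent {Y Y' : (isConnectedGSet (G := G)).FullSubcategory} (f : Y ⟶ Y')
    (hdeck : ∀ s₁ s₂ : Y.obj.V, f.hom.hom s₁ = f.hom.hom s₂ →
      ∃ σ : Aut Y, σ.hom ≫ f = f ∧ σ.hom.hom.hom s₁ = s₂)
    (z : (ofGaloisActionConnected A hZ).Φ₀.obj (op Y))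
    (hz : ∀ σ : Aut Y, σ.hom ≫ f = f → ((ofGaloisActionConnected A hZ).Φ₀.map σ.hom.op).hom z = z) :
    ∃! z' : (ofGaloisActionConnected A hZ).Φ₀.obj (op Y'),
      ((ofGaloisActionConnected A hZ).Φ₀.map f.op).hom z' = z := by
  have hf : Function.Surjective f.hom.hom := hom_surjective_of_isConnectedGSet Y.property Y'.property f.hom
  have hz' : ∀ σ : Aut Y, σ.hom ≫ f = f → ∀ x, z.1 (σ.hom.hom.hom x) = z.1 x := fun σ hσ x =>
    congrArg (fun χ : A.phiZero Y.obj => χ.1 x) (hz σ hσ)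
  have hex : ∃ ψ : Y'.obj.V → Z.DIV, ∀ s, ψ (f.hom.hom s) = z.1 s := by
    refine ⟨fun t => z.1 (Function.surjInv hf t), fun s => ?_⟩
    obtain ⟨σ, hσf, hσ⟩ := hdeck _ _ (Function.surjInv_eq hf (f.hom.hom s))
    exact (hz' σ hσf (Function.surjInv hf (f.hom.hom s))).symm.trans (congrArg (fun x => z.1 x) hσ)
  obtain ⟨ψ, hψ⟩ := hex
  refine ⟨⟨ψ, fun t => ?_, fun g t =>
      descent_equivariant f.hom hf (fun g d => A.actDIV g d) z.2.2 hψ g t⟩,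
    Subtype.ext (funext fun s => hψ s), fun z'' hz'' => ?_⟩
  · obtain ⟨s, rfl⟩ := hf t
    rw [hψ]
    exact z.2.1 s
  · apply A.phiZeroPull_injective f.hom hf
    change ((ofGaloisActionConnected A hZ).Φ₀.map f.op).hom z'' = _
    rw [hz'']
    exact (Subtype.ext (funext fun s => hψ s)).symm

/-- **(B) over `D₀` proper (`DivisorMonoids.ofGaloisActionConnected`)**: along a covering map of connected coverings
whose deck transformations act transitively on the fibres, a deck-invariant element of `B₀(Y)` is `B₀(f)` of a
unique element of `B₀(Y′)`. [cite: MochizukiEtTh2009, Def 3.3 p.73] -/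
theorem ofGaloisActionConnected_B₀_descent {Y Y' : (isConnectedGSet (G := G)).FullSubcategory} (f : Y ⟶ Y')
    (hdeck : ∀ s₁ s₂ : Y.obj.V, f.hom.hom s₁ = f.hom.hom s₂ →
      ∃ σ : Aut Y, σ.hom ≫ f = f ∧ σ.hom.hom.hom s₁ = s₂)
    (t : (ofGaloisActionConnected A hZ).B₀.obj (op Y))
    (ht : ∀ σ : Aut Y, σ.hom ≫ f = f → ((ofGaloisActionConnected A hZ).B₀.map σ.hom.op).hom t = t) :
    ∃! t' : (ofGaloisActionConnected A hZ).B₀.obj (op Y'),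
      ((ofGaloisActionConnected A hZ).B₀.map f.op).hom t' = t := by
  have hf : Function.Surjective f.hom.hom := hom_surjective_of_isConnectedGSet Y.property Y'.property f.hom
  have ht' : ∀ σ : Aut Y, σ.hom ≫ f = f → ∀ x, t.1 (σ.hom.hom.hom x) = t.1 x := fun σ hσ x =>
    congrArg (fun χ : A.bZero Y.obj => χ.1 x) (ht σ hσ)
  have hex : ∃ ψ : Y'.obj.V → Z.Fn, ∀ s, ψ (f.hom.hom s) = t.1 s := by
    refine ⟨fun x => t.1 (Function.surjInv hf x), fun s => ?_⟩
    obtain ⟨σ, hσf, hσ⟩ := hdeck _ _ (Function.surjInv_eq hf (f.hom.hom s))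
    exact (ht' σ hσf (Function.surjInv hf (f.hom.hom s))).symm.trans (congrArg (fun x => t.1 x) hσ)
  obtain ⟨ψ, hψ⟩ := hex
  refine ⟨⟨ψ, fun x => ?_, fun g x =>
      descent_equivariant f.hom hf (fun g y => A.actFn g y) t.2.2 hψ g x⟩,
    Subtype.ext (funext fun s => hψ s), fun t'' ht'' => ?_⟩
  · obtain ⟨s, rfl⟩ := hf x
    rw [hψ]
    exact t.2.1 s
  · apply A.bZeroPull_injective f.hom hf
    change ((ofGaloisActionConnected A hZ).B₀.map f.op).hom t'' = _
    rw [ht'']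
    exact (Subtype.ext (funext fun s => hψ s)).symm

/-- **A Galois connected covering is deck-transitive in `D₀` proper**: if the automorphisms of the `G`-set
underlying a connected covering `Y` act transitively, then for every covering map `f : Y → Y′` of connected
coverings the automorphisms of `Y` over `f` (in the full subcategory) act transitively on the fibres.
[cite: MochizukiSemiAnbd2006, Rmk. 3.1.3 p.34] -/
theorem exists_deck_connected_of_galois {Y Y' : (isConnectedGSet (G := G)).FullSubcategory}
    (hAut : ∀ s t : Y.obj.V, ∃ σ : Aut Y.obj, σ.hom.hom s = t) (f : Y ⟶ Y') (s₁ s₂ : Y.obj.V)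
    (h : f.hom.hom s₁ = f.hom.hom s₂) : ∃ σ : Aut Y, σ.hom ≫ f = f ∧ σ.hom.hom.hom s₁ = s₂ := by
  obtain ⟨σ, hσf, hσ⟩ := exists_deck_of_galois (S' := Y'.obj) Y.property.2 hAut f.hom h
  exact ⟨(isConnectedGSet (G := G)).fullyFaithfulι.preimageIso σ, ObjectProperty.hom_ext _ hσf, hσ⟩

/-- **The Galois connected coverings `G/N`, `N ⊴ G`, in `D₀` proper are deck-transitive over every covering map**
(so the descent theorems apply to them with no residual hypothesis). [cite: MochizukiSemiAnbd2006, Rmk. 3.1.3 p.34] -/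
theorem exists_deck_quotient_connected (N : Subgroup G) [N.Normal] {Y' : (isConnectedGSet (G := G)).FullSubcategory}
    (f : (⟨Action.ofMulAction G (G ⧸ N), isConnectedGSet_quotient N⟩ :
      (isConnectedGSet (G := G)).FullSubcategory) ⟶ Y')
    (s₁ s₂ : G ⧸ N) (h : f.hom.hom s₁ = f.hom.hom s₂) :
    ∃ σ : Aut (⟨Action.ofMulAction G (G ⧸ N), isConnectedGSet_quotient N⟩ :
      (isConnectedGSet (G := G)).FullSubcategory), σ.hom ≫ f = f ∧ σ.hom.hom.hom s₁ = s₂ :=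
  exists_deck_connected_of_galois (exists_aut_apply_eq_quotient N) f s₁ s₂ h

/-- **(Q) in `D₀` proper**: a covering map `f : Y → Y′` of CONNECTED coverings whose deck transformations act
transitively on the fibres is a categorical quotient of `Y` by its deck group in the category of connected
coverings: every deck-invariant covering map `q : Y → W` to a connected covering factors UNIQUELY through `f`
([FrdI] §0; the input (Q) of `BaseFrobeniusTypeData.existsUnique_fac_of_descent` read in Def. 3.3's `D₀`).
[cite: MochizukiEtTh2009, Rmk 4.1.1 p.88] -/
theorem existsUnique_fac_connected {Y Y' W : (isConnectedGSet (G := G)).FullSubcategory} (f : Y ⟶ Y')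
    (hdeck : ∀ s₁ s₂ : Y.obj.V, f.hom.hom s₁ = f.hom.hom s₂ →
      ∃ σ : Aut Y, σ.hom ≫ f = f ∧ σ.hom.hom.hom s₁ = s₂)
    (q : Y ⟶ W) (hq : ∀ σ : Aut Y, σ.hom ≫ f = f → σ.hom ≫ q = q) : ∃! q' : Y' ⟶ W, f ≫ q' = q := by
  have hf : Function.Surjective f.hom.hom := hom_surjective_of_isConnectedGSet Y.property Y'.property f.hom
  have hq' : ∀ σ : Aut Y.obj, σ.hom ≫ f.hom = f.hom → σ.hom ≫ q.hom = q.hom := fun σ hσ => by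
    have h := hq ((isConnectedGSet (G := G)).fullyFaithfulι.preimageIso σ) (ObjectProperty.hom_ext _ hσ)
    exact congrArg InducedCategory.Hom.hom h
  obtain ⟨q₀, hq₀, huniq⟩ :=
    existsUnique_fac_of_deckInvariant f.hom (exists_deck_obj_of_exists_deck f hdeck) hf q.hom hq'
  refine ⟨ObjectProperty.homMk q₀, ObjectProperty.hom_ext _ hq₀, fun q'' hq'' => ?_⟩
  exact ObjectProperty.hom_ext _ (huniq q''.hom (congrArg InducedCategory.Hom.hom hq''))

/-- **(Φ) and (B) in `D₀` proper, in the shape consumed by `BaseFrobeniusTypeData.existsUnique_fac_of_descent`**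
(its binders `hΦ`, `hB`, read for the Def. 3.3 (iii) data `ofGaloisActionConnected A hZ`): along every covering
map `p : Y → Y′` of connected coverings out of a GALOIS `Y` (the automorphisms of its `G`-set act transitively),
deck-invariant elements of `Φ₀(Y)`, `B₀(Y)` descend AND `pullGp Φ₀ p`, `pull B₀ p` are injective — NO residual
hypothesis. [cite: MochizukiEtTh2009, Rmk 4.1.1 p.88] -/
theorem ofGaloisActionConnected_galoisDescent {Y Y' : (isConnectedGSet (G := G)).FullSubcategory}
    (hAut : ∀ s t : Y.obj.V, ∃ σ : Aut Y.obj, σ.hom.hom s = t) (p : Y ⟶ Y') :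
    ((∀ z : (ofGaloisActionConnected A hZ).Φ₀.obj (op Y),
        (∀ g : Aut Y, g.hom ≫ p = p → pull (ofGaloisActionConnected A hZ).Φ₀ g.hom z = z) →
          ∃ z' : (ofGaloisActionConnected A hZ).Φ₀.obj (op Y'), pull (ofGaloisActionConnected A hZ).Φ₀ p z' = z) ∧
      Function.Injective (pullGp (ofGaloisActionConnected A hZ).Φ₀ p)) ∧
    ((∀ t : (ofGaloisActionConnected A hZ).B₀.obj (op Y),
        (∀ g : Aut Y, g.hom ≫ p = p → pull (ofGaloisActionConnected A hZ).B₀ g.hom t = t) →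
          ∃ t' : (ofGaloisActionConnected A hZ).B₀.obj (op Y'), pull (ofGaloisActionConnected A hZ).B₀ p t' = t) ∧
      Function.Injective (pull (ofGaloisActionConnected A hZ).B₀ p)) := by
  have hdeck := exists_deck_connected_of_galois hAut p
  refine ⟨⟨fun z hz => (ofGaloisActionConnected_Φ₀_descent A hZ p hdeck z hz).exists, ?_⟩,
    ⟨fun t ht => (ofGaloisActionConnected_B₀_descent A hZ p hdeck t ht).exists,
      ofGaloisActionConnected_B₀_map_injective A hZ p.op⟩⟩
  have h₁ : IsCancelMul ((ofGaloisActionConnected A hZ).Φ₀.obj (op Y)) := by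
    change IsCancelMul (A.phiZero Y.obj)
    infer_instance
  have h₂ : IsCancelMul ((ofGaloisActionConnected A hZ).Φ₀.obj (op Y')) := by
    change IsCancelMul (A.phiZero Y'.obj)
    infer_instance
  exact gpMap_injective (pull (ofGaloisActionConnected A hZ).Φ₀ p) (ofGaloisActionConnected_Φ₀_map_injective A hZ p.op)

/-- **(Q), (Φ), (B) at the Galois coverings `G/N → Y′`, `N ⊴ G`, of `D₀` proper** — all three inputs of
Remark 4.1.1's conjunct (2) (as reduced by `BaseFrobeniusTypeData.existsUnique_fac_of_descent`) HOLD for the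
Def. 3.3 (iii) data `ofGaloisActionConnected A hZ` along every covering map out of `G/N`, unconditionally.
[cite: MochizukiEtTh2009, Rmk 4.1.1 p.88] -/
theorem ofGaloisActionConnected_galoisDescent_quotient (N : Subgroup G) [N.Normal]
    {Y' : (isConnectedGSet (G := G)).FullSubcategory}
    (p : (⟨Action.ofMulAction G (G ⧸ N), isConnectedGSet_quotient N⟩ :
      (isConnectedGSet (G := G)).FullSubcategory) ⟶ Y') :
    (∀ (W : (isConnectedGSet (G := G)).FullSubcategory)
        (q : (⟨Action.ofMulAction G (G ⧸ N), isConnectedGSet_quotient N⟩ :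
          (isConnectedGSet (G := G)).FullSubcategory) ⟶ W),
        (∀ σ : Aut (⟨Action.ofMulAction G (G ⧸ N), isConnectedGSet_quotient N⟩ :
          (isConnectedGSet (G := G)).FullSubcategory), σ.hom ≫ p = p → σ.hom ≫ q = q) →
        ∃! q' : Y' ⟶ W, p ≫ q' = q) ∧
    ((∀ z : (ofGaloisActionConnected A hZ).Φ₀.obj (op ⟨Action.ofMulAction G (G ⧸ N), isConnectedGSet_quotient N⟩),
        (∀ g : Aut (⟨Action.ofMulAction G (G ⧸ N), isConnectedGSet_quotient N⟩ :
            (isConnectedGSet (G := G)).FullSubcategory),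
          g.hom ≫ p = p → pull (ofGaloisActionConnected A hZ).Φ₀ g.hom z = z) →
          ∃ z' : (ofGaloisActionConnected A hZ).Φ₀.obj (op Y'), pull (ofGaloisActionConnected A hZ).Φ₀ p z' = z) ∧
      Function.Injective (pullGp (ofGaloisActionConnected A hZ).Φ₀ p)) ∧
    ((∀ t : (ofGaloisActionConnected A hZ).B₀.obj (op ⟨Action.ofMulAction G (G ⧸ N), isConnectedGSet_quotient N⟩),
        (∀ g : Aut (⟨Action.ofMulAction G (G ⧸ N), isConnectedGSet_quotient N⟩ :
            (isConnectedGSet (G := G)).FullSubcategory),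
          g.hom ≫ p = p → pull (ofGaloisActionConnected A hZ).B₀ g.hom t = t) →
          ∃ t' : (ofGaloisActionConnected A hZ).B₀.obj (op Y'), pull (ofGaloisActionConnected A hZ).B₀ p t' = t) ∧
      Function.Injective (pull (ofGaloisActionConnected A hZ).B₀ p)) :=
  ⟨fun _ q hq => existsUnique_fac_connected p (exists_deck_quotient_connected N p) q hq,
    ofGaloisActionConnected_galoisDescent A hZ (exists_aut_apply_eq_quotient N) p⟩

end DivisorMonoids

end Literature.AnabelianGeometry.EtaleTheta
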